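import Mathlib.Analysis.InnerProductSpace.PiL2

/-!
# `StrictSplittingRule` (stmt-AtomisticToContinuum-12560): the quadratic Hardy profile against inverse-sixth-power bond weights

Route `FreeSplittingCertificates`, crux r3 `StrictSplittingRule`, line `registered` (unit b2b-freesplit-B, gen 6).
Companion of `…StrictSplittingRuleGroundStateHardy.lean`: there the discrete Hardy inequality
`Σ_x w_x f_x² ≤ Σ_e c_e (f_{e₁} − f_{e₂})²` is reduced to exhibiting a nonnegative SUPERSOLUTION `φ` of the
weighted graph Laplacian, `w φ ≤ L_c φ`, `(L_c φ)(x) = Σ_{y ∼ x} c_{xy} (φ(x) − φ(y))`.  In the far lemma of the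
H12⋆ architecture (HOME CERT.md §14 (3), FAR-LEMMA-SPEC.md) the bond weights are the receipts of an `r⁻⁶`
import family seen from BOTH ends of a first-shell bond, `c_{x,x+s} = c₆ (‖y_x‖⁻⁶ + ‖y_{x+s}‖⁻⁶)` (`y` = position
relative to the reference site `P`), and the natural profile is the QUADRATIC one, `φ(x) = ‖y_x‖²`, for which every
difference is exact: `φ(x+s) − φ(x) = 2⟪y_x, e_s⟫ + ‖e_s‖²` for the bond vector `e_s = y_{x+s} − y_x`.

Writing `r₂ = ‖y_x‖²`, `σ_s = ‖y_{x+s}‖² = r₂ + δ_s`, the contribution of the bond `s` to `(L_c φ)(x)/c₆` is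
`(r₂⁻³ + σ_s⁻³)(r₂ − σ_s)`, and this file records the exact algebra that turns the shell sum into MOMENTS of `δ`:

* `hardyProfile_term_eq` — `(r₂⁻³ + σ⁻³)(r₂ − σ) = r₂⁻³ · (−2δ + δ²·(σ² + σ r₂ + r₂²)/σ³)`, `δ = σ − r₂`
  (the first-order parts of the two ends are EQUAL, `−δ r₂⁻³` each; the remainder is an explicit nonnegative square);
* `hardyProfile_kernel_ge` — convexity of `σ ↦ σ⁻¹ + r₂ σ⁻² + r₂² σ⁻³`: the remainder kernel is at least its tangent
  at `σ = r₂`, `(σ² + σ r₂ + r₂²)/σ³ ≥ 3/r₂ − 6 δ/r₂²` for `σ > 0`;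
* `hardyProfile_term_ge` — hence `(r₂⁻³ + σ⁻³)(r₂ − σ) ≥ r₂⁻³ (−2δ + 3δ²/r₂ − 6δ³/r₂²)`;
* `hardyProfile_sum_ge` — summed over any finite family of bonds:
  `Σ_s (r₂⁻³ + σ_s⁻³)(r₂ − σ_s) ≥ r₂⁻³ (−2 Σ_s δ_s + (3/r₂) Σ_s δ_s² − (6/r₂²) Σ_s δ_s³)` — the MOMENT FORM of the
  supersolution margin, to be fed with the hcp shell moments `Σ_s e_s = 0`, `Σ_s e_s ⊗ e_s = diag(4a², 4a², 6h²)`,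
  `Σ_s ‖e_s‖² e_s = 0` (so `Σ δ = Σ‖e_s‖²`, `Σ δ² = 4 yᵀ(Σ e_s⊗e_s) y + Σ‖e_s‖⁴`, and `Σ δ³` is a third moment);
* `hardyProfile_sum_nonneg_remainder` — the cruder but sign-free form `Σ_s (…) ≥ −2 r₂⁻³ Σ_s δ_s`.

Numerically (HOME/code/partB/gen6-farlemma, float, `(a₀,h₀) = (0.97129, 0.79294)`): the exact margin
`κ(x) := ‖y_x‖⁸ (L_c φ)(x) / (c₆ φ(x))` is `≥ 23.0` at EVERY hcp site with `2a ≤ ‖y_x‖ ≤ 9a` and tends to `24 a²`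
(the continuum value `γ(5 − γ)·4a²` at `γ = 2`; the optimum `γ = 5/2` would give `25 a²`), i.e. the discrete weighted
Hardy inequality `Σ_x 23·c₆ ‖y_x‖⁻⁸ f_x² ≤ Σ_x c₆‖y_x‖⁻⁶ Σ_{s ∈ shell(x)} (f_{x+s} − f_x)²` holds on the hcp exterior for
`f` vanishing on `‖y‖ < 2a`; the moment form above yields an explicit positive margin beyond a few lattice spacings once
the shell moments are supplied (leading term `(12·m₂ − 2 Σ_s‖e_s‖²)` with `m₂ = min(4a², 6h²)`, i.e. `24a²` for ideal
hcp), and the inner shells are a finite rational check.  Structural bookkeeping ([folklore]); VALUE = a kernel-checked brick of the far lemma —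
NOT summit progress.
-/

namespace Summit.AtomisticToContinuum.Crystallization.Theorems.StrictSplittingRuleBirth

open scoped BigOperators

/-- **One bond, exactly.**  For `r₂, σ ≠ 0` and `δ = σ − r₂`:
`(r₂⁻³ + σ⁻³)(r₂ − σ) = r₂⁻³ (−2δ + δ² (σ² + σ r₂ + r₂²)/σ³)`. [folklore] -/
theorem hardyProfile_term_eq {r₂ σ : ℝ} (hr : r₂ ≠ 0) (hσ : σ ≠ 0) :
    ((r₂ ^ 3)⁻¹ + (σ ^ 3)⁻¹) * (r₂ - σ) =
      (r₂ ^ 3)⁻¹ * (-2 * (σ - r₂) + (σ - r₂) ^ 2 * ((σ ^ 2 + σ * r₂ + r₂ ^ 2) / σ ^ 3)) := by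
  field_simp
  ring

/-- The remainder kernel is nonnegative: `(σ² + σ r₂ + r₂²)/σ³ ≥ 0` for `σ > 0`, `r₂ ≥ 0`. [folklore] -/
theorem hardyProfile_kernel_nonneg {r₂ σ : ℝ} (hr : 0 ≤ r₂) (hσ : 0 < σ) :
    0 ≤ (σ ^ 2 + σ * r₂ + r₂ ^ 2) / σ ^ 3 := by
  positivity

/-- **Tangent bound of the (convex) remainder kernel** at `σ = r₂`: for `σ, r₂ > 0`,
`(σ² + σ r₂ + r₂²)/σ³ ≥ 3/r₂ − 6 (σ − r₂)/r₂²`. [folklore] -/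
theorem hardyProfile_kernel_ge {r₂ σ : ℝ} (hr : 0 < r₂) (hσ : 0 < σ) :
    3 / r₂ - 6 * (σ - r₂) / r₂ ^ 2 ≤ (σ ^ 2 + σ * r₂ + r₂ ^ 2) / σ ^ 3 := by
  rw [show 3 / r₂ - 6 * (σ - r₂) / r₂ ^ 2 = (9 * r₂ - 6 * σ) / r₂ ^ 2 by field_simp; ring]
  rw [div_le_div_iff₀ (by positivity) (by positivity)]
  -- (9 r₂ − 6σ) σ³ ≤ (σ² + σ r₂ + r₂²) r₂² ⟸ the difference is (σ − r₂)²·(6σ² + 3σ r₂ + r₂²) ≥ 0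
  nlinarith [sq_nonneg (σ - r₂), mul_pos hσ hr, sq_nonneg σ, sq_nonneg r₂,
    mul_nonneg (sq_nonneg (σ - r₂)) (by positivity : (0 : ℝ) ≤ 6 * σ ^ 2 + 3 * σ * r₂ + r₂ ^ 2)]

/-- **One bond, moment form.**  For `r₂, σ > 0` and `δ = σ − r₂`:
`(r₂⁻³ + σ⁻³)(r₂ − σ) ≥ r₂⁻³ (−2δ + 3δ²/r₂ − 6δ³/r₂²)`. [folklore] -/
theorem hardyProfile_term_ge {r₂ σ : ℝ} (hr : 0 < r₂) (hσ : 0 < σ) :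
    (r₂ ^ 3)⁻¹ * (-2 * (σ - r₂) + 3 * (σ - r₂) ^ 2 / r₂ - 6 * (σ - r₂) ^ 3 / r₂ ^ 2) ≤
      ((r₂ ^ 3)⁻¹ + (σ ^ 3)⁻¹) * (r₂ - σ) := by
  rw [hardyProfile_term_eq hr.ne' hσ.ne']
  refine mul_le_mul_of_nonneg_left ?_ (by positivity)
  have hk := hardyProfile_kernel_ge hr hσ
  have hδ : 0 ≤ (σ - r₂) ^ 2 := sq_nonneg _
  have : 3 * (σ - r₂) ^ 2 / r₂ - 6 * (σ - r₂) ^ 3 / r₂ ^ 2 =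
      (σ - r₂) ^ 2 * (3 / r₂ - 6 * (σ - r₂) / r₂ ^ 2) := by ring
  rw [add_sub_assoc, this]
  have hm := mul_le_mul_of_nonneg_left hk hδ
  linarith

/-- **Shell sum, moment form.**  For `r₂ > 0` and a finite family of positive `σ_s` (`δ_s = σ_s − r₂`):
`Σ_s (r₂⁻³ + σ_s⁻³)(r₂ − σ_s) ≥ r₂⁻³ (−2 Σ δ_s + (3/r₂) Σ δ_s² − (6/r₂²) Σ δ_s³)`. [folklore] -/
theorem hardyProfile_sum_ge {ι : Type*} (S : Finset ι) {r₂ : ℝ} (hr : 0 < r₂) (σ : ι → ℝ)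
    (hσ : ∀ s ∈ S, 0 < σ s) :
    (r₂ ^ 3)⁻¹ * (-2 * ∑ s ∈ S, (σ s - r₂) + 3 / r₂ * ∑ s ∈ S, (σ s - r₂) ^ 2 -
        6 / r₂ ^ 2 * ∑ s ∈ S, (σ s - r₂) ^ 3) ≤
      ∑ s ∈ S, ((r₂ ^ 3)⁻¹ + (σ s ^ 3)⁻¹) * (r₂ - σ s) := by
  have hrw : (r₂ ^ 3)⁻¹ * (-2 * ∑ s ∈ S, (σ s - r₂) + 3 / r₂ * ∑ s ∈ S, (σ s - r₂) ^ 2 -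
        6 / r₂ ^ 2 * ∑ s ∈ S, (σ s - r₂) ^ 3) =
      ∑ s ∈ S, (r₂ ^ 3)⁻¹ * (-2 * (σ s - r₂) + 3 * (σ s - r₂) ^ 2 / r₂ - 6 * (σ s - r₂) ^ 3 / r₂ ^ 2) := by
    rw [Finset.mul_sum, Finset.mul_sum, Finset.mul_sum, ← Finset.sum_add_distrib, ← Finset.sum_sub_distrib,
      Finset.mul_sum]
    refine Finset.sum_congr rfl fun s _ => ?_
    field_simp
  rw [hrw]
  exact Finset.sum_le_sum fun s hs => hardyProfile_term_ge hr (hσ s hs)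

/-- **Shell sum, sign-free remainder dropped**: `Σ_s (r₂⁻³ + σ_s⁻³)(r₂ − σ_s) ≥ −2 r₂⁻³ Σ_s (σ_s − r₂)`
(`r₂ > 0`, `σ_s > 0`). [folklore] -/
theorem hardyProfile_sum_nonneg_remainder {ι : Type*} (S : Finset ι) {r₂ : ℝ} (hr : 0 < r₂) (σ : ι → ℝ)
    (hσ : ∀ s ∈ S, 0 < σ s) :
    -2 * (r₂ ^ 3)⁻¹ * ∑ s ∈ S, (σ s - r₂) ≤ ∑ s ∈ S, ((r₂ ^ 3)⁻¹ + (σ s ^ 3)⁻¹) * (r₂ - σ s) := by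
  rw [Finset.mul_sum]
  refine Finset.sum_le_sum fun s hs => ?_
  rw [hardyProfile_term_eq hr.ne' (hσ s hs).ne', mul_comm (-2) ((r₂ ^ 3)⁻¹), mul_assoc]
  refine mul_le_mul_of_nonneg_left ?_ (by positivity)
  have := mul_nonneg (sq_nonneg (σ s - r₂)) (hardyProfile_kernel_nonneg hr.le (hσ s hs))
  linarith

/-- **The quadratic profile's differences are exact**: for `y e` in `ℝ³`,
`‖y + e‖² − ‖y‖² = 2⟪y, e⟫ + ‖e‖²` (so `δ_s = 2⟪y_x, e_s⟫ + ‖e_s‖²` for the bond vector `e_s`). [folklore] -/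
theorem hardyProfile_delta_eq (y e : EuclideanSpace ℝ (Fin 3)) :
    ‖y + e‖ ^ 2 - ‖y‖ ^ 2 = 2 * inner ℝ y e + ‖e‖ ^ 2 := by
  rw [norm_add_sq_real]
  ring

/-- **First two moments of `δ` from the shell moments.**  For a finite family of bond vectors `e_s` with
`Σ_s e_s = 0` and `Σ_s ‖e_s‖² e_s = 0`, and `δ_s = 2⟪y, e_s⟫ + ‖e_s‖²`:
`Σ_s δ_s = Σ_s ‖e_s‖²` and `Σ_s δ_s² = 4 Σ_s ⟪y, e_s⟫² + Σ_s ‖e_s‖⁴`. [folklore] -/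
theorem hardyProfile_moments {ι : Type*} (S : Finset ι) (e : ι → EuclideanSpace ℝ (Fin 3))
    (y : EuclideanSpace ℝ (Fin 3)) (h1 : ∑ s ∈ S, e s = 0) (h3 : ∑ s ∈ S, ‖e s‖ ^ 2 • e s = 0) :
    (∑ s ∈ S, (2 * inner ℝ y (e s) + ‖e s‖ ^ 2) = ∑ s ∈ S, ‖e s‖ ^ 2) ∧
    (∑ s ∈ S, (2 * inner ℝ y (e s) + ‖e s‖ ^ 2) ^ 2 =
      4 * ∑ s ∈ S, (inner ℝ y (e s)) ^ 2 + ∑ s ∈ S, ‖e s‖ ^ 4) := by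
  have hlin : ∑ s ∈ S, inner ℝ y (e s) = 0 := by
    rw [← inner_sum, h1, inner_zero_right]
  have hcub : ∑ s ∈ S, ‖e s‖ ^ 2 * inner ℝ y (e s) = 0 := by
    have : ∑ s ∈ S, ‖e s‖ ^ 2 * inner ℝ y (e s) = inner ℝ y (∑ s ∈ S, ‖e s‖ ^ 2 • e s) := by
      rw [inner_sum]
      exact Finset.sum_congr rfl fun s _ => by rw [real_inner_smul_right]
    rw [this, h3, inner_zero_right]
  constructor
  · rw [Finset.sum_add_distrib, ← Finset.mul_sum, hlin, mul_zero, zero_add]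
  · have : ∀ s ∈ S, (2 * inner ℝ y (e s) + ‖e s‖ ^ 2) ^ 2 =
        4 * (inner ℝ y (e s)) ^ 2 + 4 * (‖e s‖ ^ 2 * inner ℝ y (e s)) + ‖e s‖ ^ 4 := fun s _ => by ring
    rw [Finset.sum_congr rfl this, Finset.sum_add_distrib, Finset.sum_add_distrib, ← Finset.mul_sum,
      ← Finset.mul_sum, hcub, mul_zero, add_zero]

end Summit.AtomisticToContinuum.Crystallization.Theorems.StrictSplittingRuleBirth
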